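import Mathlib.MeasureTheory.Integral.IntervalIntegral.FundThmCalculus
import Summits.NavierStokesRegularity.FunctionalMining.BiaxialContact
import Summits.NavierStokesRegularity.FunctionalMining.BiaxialXRay
import Summits.NavierStokesRegularity.FunctionalMining.TopEigHeatDanskin
import Summits.NavierStokesRegularity.FunctionalMining.TopEigHeatCoerciveGap
import HarnessLib

/-!
# FunctionalMining / NoGo — K56a: LATTICE-LINE CALCULUS for (F2) witnesses — the tree's X-RAY
# IDENTITY in Rayleigh form, the open-segment FTC `∫ₐᵇ Kᵀ S K dt = ⟪K, v(end)⟫ − ⟪K, v(start)⟫`,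
# SHORT ALIGNED FIBRES in every direction (`‖K‖(b − a) ≤ 2‖v‖_∞/((1 − ε) m)`), and the
# `‖K‖²`-Rayleigh pair on `T³` (first of two files; K56b `TopEigLatticeLineSpread` has the spreads)

HONEST FRAMING. Search for candidate a priori estimates; no regularity claim. Nothing about
Navier–Stokes is proved or asserted in this file. Cell `pub-nsfunc`, no-go seat (gen 52; v3 = the
v2 content split in two files under the 400-line rule of `lean/CONVENTIONS.md`). Static calculus
of smooth fields on the flat torus (no heat flow enters): the line calculus behind the (F2) design
rules (R13)/(R13⁺)/(R13⁺⁺) of `NOGO.md` door (b), along straight lines of ARBITRARY direction.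

CONTEXT. (F2) is the WANTED kernel negation `¬ TopEigHeatCoercivePos q` of the open node Lemma
L-λ(q): a KILLING FAMILY `v_n` with `heatDissipation Φ_q v_n / Φ_q v_n → 0`
(`Φ_q = torusTopEigMoment q = ∫ (λ₁⁺)^q`, `λ₁ = torusStrainTopEig v`). The mechanism behind
(R13) FRAME SPREAD (K54) and (R13⁺) LINE SPREAD (K55) is one identity: for a FIXED vector
`K ∈ ℝ^d` the Rayleigh numerator of the strain is an exact derivative ALONG `K`,
`Kᵀ S(v)(y) K = ∂_K ⟪K, v⟫ (y)`. Integrating it along `t ↦ x + proj (t • K)` gives a boundary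
term `⟪K, v(end)⟫ − ⟪K, v(start)⟫`, which (i) VANISHES on every CLOSED line (`K = latticeVec k`,
parameter length `1`) and (ii) is bounded by `2 ‖K‖ ‖v‖_∞` on every segment WHATEVER its length.

CONTENT (`v` smooth on `T^d = UnitAddTorus d`; § 4 on `T³`, divergence free; `γ(t) = x + proj (t • K)`).
PRIOR TREE CONTENT (imported and used, not re-proved): the line calculus and the X-RAY IDENTITY of
`FunctionalMining/BiaxialXRay.lean` (prove seat gen 20, namespace `BiaxialEikonal`):
`hasDerivAt_line`, `hasDerivAt_longitudinal` (`d/dt (K·v)(x + proj (t • K)) = ∑ᵢⱼ KᵢKⱼ∂ⱼvᵢ`),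
`sum_partialDeriv_eq_sum_strain`, `continuous_longitudinalStrain` and
**`intervalIntegral_longitudinalStrain_eq_zero`** (`∫₀¹ kᵀ S(v)(x + tk) k dt = 0` for every lattice
`k` and every `x` — "the longitudinal strain integrates to zero along every closed lattice line"),
with the Rolle corollary `exists_longitudinalStrain_eq_zero`. § 1–§ 2 below only REWRITE these
(inner product `⟪K, v ·⟫`, factor order `Kᵢ Sᵢⱼ Kⱼ`, set integral over `Ioc 0 1`, free base
parameter) and add the open-SEGMENT FTC; the new content is § 3 here and § 5, § 6 of K56b.
§ 1 (any `d`) **`hasDerivAt_inner_line`** `d/dt ⟪K, v(γ t)⟫ = Kᵀ S(γ t) K` (= the tree's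
`hasDerivAt_longitudinal` + `sum_partialDeriv_eq_sum_strain`, rewritten).
§ 2 (any `d`) segment FTC **`intervalIntegral_quadStrain_line`**
`∫ₐᵇ Kᵀ S(γ t) K dt = ⟪K, v(γ b)⟫ − ⟪K, v(γ a)⟫` for every `a, b` and every `K`
(Mathlib `intervalIntegral.integral_eq_sub_of_hasDerivAt`); closed lattice lines
**`proj_add_intCast_smul_latticeVec`** `proj ((t + n) • latticeVec k) = proj (t • latticeVec k)`;
ZERO MEAN **`setIntegral_quadStrain_latticeLine_eq_zero`** (= the tree's X-ray identity, rewritten)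
and **`intervalIntegral_quadStrain_latticeLine_eq_zero`** `∫ₐ^{a+1} Kᵀ S(γ t) K dt = 0` for
`K = latticeVec k`, every `k ∈ ℤ^d`, every base point and base parameter; boundary control
**`abs_inner_sub_inner_le_norm_mul`** `|⟪K, w₁⟫ − ⟪K, w₀⟫| ≤ ‖K‖ (‖w₁‖ + ‖w₀‖)`.
§ 3 (any `d`, NO divergence constraint) ALIGNED STRAIGHT FIBRES ARE SHORT:
**`aligned_segment_length_mul_le`** if `(1 − ε)‖K‖²λ₁ ≤ Kᵀ S K` and `m ≤ λ₁` along `γ([a, b])`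
(`ε ≤ 1`) then `(1 − ε) ‖K‖² m (b − a) ≤ ⟪K, v(γ b)⟫ − ⟪K, v(γ a)⟫`; **`aligned_segment_length_le`**
with `‖v‖ ≤ M`: Euclidean length `‖K‖ (b − a) ≤ 2M / ((1 − ε) m)`.
§ 4 (`T³`, divergence free) **`quadStrain_le_norm_sq_mul_top`** `Kᵀ S K ≤ ‖K‖² λ₁` and
**`neg_two_mul_norm_sq_mul_top_le_quadStrain`** `−2‖K‖² λ₁ ≤ Kᵀ S K` (tree
`BiaxialEikonal.quadStrain_le_top` / `neg_two_mul_top_le_quadStrain` at `K/‖K‖`); on a closed lattice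
line LINE MISALIGNMENT = LINE MASS **`setIntegral_norm_sq_mul_top_sub_quadStrain_eq`**
`∫_{(0,1]} (‖K‖² λ₁ − Kᵀ S K) = ‖K‖² ∫_{(0,1]} λ₁` (`K = latticeVec k`).
MEANING, see K56b (`NoGo/TopEigLatticeLineSpread`): § 3 says that on a plateau `{λ₁ ≥ m}` a
straight fibre of ANY direction along which the top direction stays `ε`-close to the fibre
direction has Euclidean length at most `2‖v‖_∞/((1 − ε) m)` — alignment is limited by the
OSCILLATION OF THE VELOCITY, not by periodicity; nothing here bounds `heatDissipation`, (F2) stays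
WANTED/OPEN and L-λ(q) OPEN for every real `q > 1`.
[ours = assembly (§ 3); tree = `BiaxialXRay` line calculus + X-ray identity (§ 1–§ 2),
`BiaxialContact` Rayleigh pair (§ 4); folklore = FTC, Cauchy–Schwarz]
FILING (prove seat g29, REQUEST #84a): = the no-go seat's staged `TopEigLatticeLineFibre.STAGING.lean` d122dc622bc9bad8 with this line added and ONE (ω)-normal-form dedup fix: the [folklore] lemma `inner_eq_sum_mul_coord` (≡ landed `Literature.MathematicalPhysics.KineticTheory.inner_eq_sum_apply`, gate dedup.landed at dry-run) is DELETED and its two-line Mathlib proof (`PiLp.inner_apply`) inlined at its single use; every other declaration byte-identical.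
-/

noncomputable section

open MeasureTheory Set Filter Topology
open scoped InnerProductSpace

namespace Summit.NavierStokesRegularity.FunctionalMining
open Literature.Analysis Literature.Analysis.FunctionSpaces Literature.Analysis.FunctionSpaces.Torus
  Literature.Analysis.FluidPDE TopEig BiaxialEikonal

namespace TopEig

namespace LatticeLineFibre

/-! ## 1. The Rayleigh sum of a fixed vector is a derivative along that vector -/

section General

variable {d : Type*} [Fintype d] [DecidableEq d]
variable {v : UnitAddTorus d → EuclideanSpace ℝ d}

/-- Continuity of a strain entry `y ↦ S(v)(y)ᵢⱼ`. [folklore] -/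
theorem continuous_torusStrainMatrix_apply (hv : Torus.IsSmooth v) (i j : d) :
    Continuous fun y => torusStrainMatrix v y i j := by
  simp only [torusStrainMatrix, Matrix.of_apply]
  exact (((hv.partialDeriv j).apply i).continuous.add ((hv.partialDeriv i).apply j).continuous).div_const 2

/-- Continuity of the Rayleigh sum `y ↦ Kᵀ S(v)(y) K`. [folklore] -/
theorem continuous_quadStrain_vec (hv : Torus.IsSmooth v) (K : EuclideanSpace ℝ d) :
    Continuous fun y => ∑ i, ∑ j, K i * torusStrainMatrix v y i j * K j :=
  continuous_finsetSum _ fun i _ => continuous_finsetSum _ fun j _ =>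
    (continuous_const.mul (continuous_torusStrainMatrix_apply hv i j)).mul continuous_const

/-- **The Rayleigh sum along a line is an exact derivative** — the TREE's line calculus
`BiaxialEikonal.hasDerivAt_longitudinal` + `BiaxialEikonal.sum_partialDeriv_eq_sum_strain`
(`FunctionalMining/BiaxialXRay.lean`, prove seat gen 20), restated for the inner product
`⟪K, v ·⟫` and the factor order `Kᵢ Sᵢⱼ Kⱼ` used below: for every base point `x`, vector `K` and
parameter `t`, `d/dt ⟪K, v (x + proj (t • K))⟫ = Kᵀ S(v)(x + proj (t • K)) K`.
[tree = `BiaxialXRay`; here only the rewriting] -/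
theorem hasDerivAt_inner_line (hv : Torus.IsSmooth v) (K : EuclideanSpace ℝ d) (x : UnitAddTorus d)
    (t : ℝ) :
    HasDerivAt (fun s : ℝ => ⟪K, v (x + Torus.proj (s • K))⟫_ℝ)
      (∑ i, ∑ j, K i * torusStrainMatrix v (x + Torus.proj (t • K)) i j * K j) t := by
  have h := hasDerivAt_longitudinal hv x K t
  rw [sum_partialDeriv_eq_sum_strain] at h
  have hfun : (fun s : ℝ => ⟪K, v (x + Torus.proj (s • K))⟫_ℝ) =
      fun s : ℝ => ∑ i, K i * v (x + Torus.proj (s • K)) i := by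
    funext s
    rw [PiLp.inner_apply]
    exact Finset.sum_congr rfl fun i _ => by simp only [RCLike.inner_apply, conj_trivial]; ring
  rw [hfun]
  convert h using 1
  exact Finset.sum_congr rfl fun i _ => Finset.sum_congr rfl fun j _ => by ring

/-- Continuity of the Rayleigh sum along a line (cf. the tree's
`BiaxialEikonal.continuous_longitudinalStrain`, factor order `Kᵢ Kⱼ Sᵢⱼ`). [folklore] -/
theorem continuous_quadStrain_along (hv : Torus.IsSmooth v) (K : EuclideanSpace ℝ d)
    (x : UnitAddTorus d) :
    Continuous fun t : ℝ => ∑ i, ∑ j, K i * torusStrainMatrix v (x + Torus.proj (t • K)) i j * K j :=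
  (continuous_quadStrain_vec hv K).comp
    (continuous_const.add (Torus.continuous_proj.comp (continuous_id.smul continuous_const)))

/-- **FTC along a line SEGMENT.** `∫_a^b Kᵀ S(x + proj (t • K)) K dt = ⟪K, v(x + proj (b • K))⟫ −
⟪K, v (x + proj (a • K))⟫` for every `a b : ℝ` and every `K` — the open-segment form of the step
inside the tree's X-ray identity `BiaxialEikonal.intervalIntegral_longitudinalStrain_eq_zero`
(which integrates over the closed unit parameter interval of a lattice direction). [folklore] -/
theorem intervalIntegral_quadStrain_line (hv : Torus.IsSmooth v) (K : EuclideanSpace ℝ d)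
    (x : UnitAddTorus d) (a b : ℝ) :
    ∫ t in a..b, ∑ i, ∑ j, K i * torusStrainMatrix v (x + Torus.proj (t • K)) i j * K j =
      ⟪K, v (x + Torus.proj (b • K))⟫_ℝ - ⟪K, v (x + Torus.proj (a • K))⟫_ℝ :=
  intervalIntegral.integral_eq_sub_of_hasDerivAt (fun t _ => hasDerivAt_inner_line hv K x t)
    ((continuous_quadStrain_along hv K x).intervalIntegrable a b)

/-! ## 2. Closed lattice lines: zero mean of `Kᵀ S K` -/

/-- Integer multiples of lattice vectors are lattice vectors. [folklore] -/
theorem intCast_smul_latticeVec (n : ℤ) (k : d → ℤ) :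
    (n : ℝ) • Torus.latticeVec k = Torus.latticeVec (n • k) := by
  ext i
  simp [Torus.latticeVec_apply]

/-- A non-zero integer vector has a non-zero lattice vector. [folklore] -/
theorem latticeVec_ne_zero {k : d → ℤ} (hk : k ≠ 0) : Torus.latticeVec k ≠ 0 := by
  intro h
  apply hk
  funext i
  have hi := congrArg (fun w : EuclideanSpace ℝ d => w i) h
  simpa [Torus.latticeVec_apply] using hi

/-- The line in a lattice direction `K = latticeVec k` is CLOSED with period `1`:
`proj ((t + n) • K) = proj (t • K)` for every integer `n`. [folklore] -/
theorem proj_add_intCast_smul_latticeVec (t : ℝ) (n : ℤ) (k : d → ℤ) :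
    Torus.proj ((t + n) • Torus.latticeVec k) = Torus.proj (t • Torus.latticeVec k) := by
  rw [add_smul, intCast_smul_latticeVec, Torus.proj_add_latticeVec]

/-- In particular `proj ((t + 1) • K) = proj (t • K)`. [folklore] -/
theorem proj_add_one_smul_latticeVec (t : ℝ) (k : d → ℤ) :
    Torus.proj ((t + 1) • Torus.latticeVec k) = Torus.proj (t • Torus.latticeVec k) := by
  have h := proj_add_intCast_smul_latticeVec t 1 k
  rwa [Int.cast_one] at h

/-- **ZERO MEAN ON EVERY CLOSED LATTICE LINE = the tree's X-RAY IDENTITY.** For a smooth field `v`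
on `T^d`, every lattice direction `K = latticeVec k` (`k ∈ ℤ^d`) and every base point `x`:
`∫_{(0,1]} Kᵀ S(v)(x + proj (t • K)) K dt = 0`. This IS `BiaxialEikonal.intervalIntegral_longitudinalStrain_eq_zero`
(`FunctionalMining/BiaxialXRay.lean`, prove seat gen 20: "the longitudinal strain integrates to zero
along every closed lattice line"), rewritten as a set integral over `Ioc 0 1` with the factor order
`Kᵢ Sᵢⱼ Kⱼ` of `segmentAlignedSet` below; the proof is that theorem. [tree = `BiaxialXRay`; rewriting] -/
theorem setIntegral_quadStrain_latticeLine_eq_zero (hv : Torus.IsSmooth v) (k : d → ℤ)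
    (x : UnitAddTorus d) :
    ∫ t in Ioc (0 : ℝ) 1, ∑ i, ∑ j, Torus.latticeVec k i *
        torusStrainMatrix v (x + Torus.proj (t • Torus.latticeVec k)) i j * Torus.latticeVec k j = 0 := by
  have h := intervalIntegral_longitudinalStrain_eq_zero hv k x
  rw [intervalIntegral.integral_of_le zero_le_one] at h
  refine Eq.trans (setIntegral_congr_fun measurableSet_Ioc fun t _ => ?_) h
  exact Finset.sum_congr rfl fun i _ => Finset.sum_congr rfl fun j _ => by ring

/-- The same with a free base parameter: `∫_a^{a+1} Kᵀ S(v)(x + proj (t • K)) K dt = 0` for every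
`a : ℝ` (the line `t ↦ x + proj (t • latticeVec k)` closes after parameter `1` from any start;
segment FTC `intervalIntegral_quadStrain_line` + `proj_add_one_smul_latticeVec`). The case `a = 0` is
the tree's X-ray identity (`setIntegral_quadStrain_latticeLine_eq_zero`). [tree = `BiaxialXRay`;
bookkeeping] -/
theorem intervalIntegral_quadStrain_latticeLine_eq_zero (hv : Torus.IsSmooth v) (k : d → ℤ)
    (x : UnitAddTorus d) (a : ℝ) :
    ∫ t in a..a + 1, ∑ i, ∑ j, Torus.latticeVec k i *
        torusStrainMatrix v (x + Torus.proj (t • Torus.latticeVec k)) i j * Torus.latticeVec k j = 0 := by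
  rw [intervalIntegral_quadStrain_line hv (Torus.latticeVec k) x a (a + 1),
    proj_add_one_smul_latticeVec, sub_self]

omit [Fintype d] [DecidableEq d] in
/-- The boundary term is controlled by the velocity: `|⟪K, v(y₁)⟫ − ⟪K, v(y₀)⟫| ≤ ‖K‖ (‖v y₁‖ + ‖v y₀‖)`
(Cauchy–Schwarz). [folklore] -/
theorem abs_inner_sub_inner_le_norm_mul [Fintype d] (K : EuclideanSpace ℝ d) (w₁ w₀ : EuclideanSpace ℝ d) :
    |⟪K, w₁⟫_ℝ - ⟪K, w₀⟫_ℝ| ≤ ‖K‖ * (‖w₁‖ + ‖w₀‖) := by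
  have h1 := abs_real_inner_le_norm K w₁
  have h0 := abs_real_inner_le_norm K w₀
  have h := abs_sub _ _ |>.trans (add_le_add h1 h0)
  nlinarith [abs_sub (⟪K, w₁⟫_ℝ) (⟪K, w₀⟫_ℝ)]

/-! ## 3. Aligned straight fibres are short (every direction, every dimension) -/

/-- **ALIGNED SEGMENTS ARE SHORT.** Let `v` be smooth on `T^d`, `K ∈ ℝ^d`, and suppose that along the
straight segment `t ↦ x + proj (t • K)`, `t ∈ [a, b]`, the vector `K` is `ε`-aligned with the top
frame, `(1 − ε) ‖K‖² λ₁ ≤ Kᵀ S K`, and `m ≤ λ₁` (`ε ≤ 1`). Then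
`(1 − ε) ‖K‖² m (b − a) ≤ ⟪K, v(x + proj (b • K))⟫ − ⟪K, v(x + proj (a • K))⟫`: the aligned length
is paid for by the OSCILLATION OF THE VELOCITY along the segment. No divergence constraint is used.
[ours] -/
theorem aligned_segment_length_mul_le (hv : Torus.IsSmooth v) (K : EuclideanSpace ℝ d)
    (x : UnitAddTorus d) {a b ε m : ℝ} (hab : a ≤ b) (hε : ε ≤ 1)
    (hal : ∀ t ∈ Icc a b, (1 - ε) * ‖K‖ ^ 2 * torusStrainTopEig v (x + Torus.proj (t • K)) ≤
      ∑ i, ∑ j, K i * torusStrainMatrix v (x + Torus.proj (t • K)) i j * K j)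
    (hm : ∀ t ∈ Icc a b, m ≤ torusStrainTopEig v (x + Torus.proj (t • K))) :
    (1 - ε) * ‖K‖ ^ 2 * m * (b - a) ≤
      ⟪K, v (x + Torus.proj (b • K))⟫_ℝ - ⟪K, v (x + Torus.proj (a • K))⟫_ℝ := by
  rw [← intervalIntegral_quadStrain_line hv K x a b]
  have hc : 0 ≤ (1 - ε) * ‖K‖ ^ 2 := mul_nonneg (sub_nonneg.mpr hε) (sq_nonneg _)
  have hmono : ∫ _ in a..b, (1 - ε) * ‖K‖ ^ 2 * m ≤
      ∫ t in a..b, ∑ i, ∑ j, K i * torusStrainMatrix v (x + Torus.proj (t • K)) i j * K j :=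
    intervalIntegral.integral_mono_on hab intervalIntegrable_const
      ((continuous_quadStrain_along hv K x).intervalIntegrable a b) fun t ht =>
      (mul_le_mul_of_nonneg_left (hm t ht) hc).trans (hal t ht)
  rw [intervalIntegral.integral_const, smul_eq_mul] at hmono
  linarith

/-- **ALIGNED FIBRE LENGTH BOUND.** With `‖v‖ ≤ M` everywhere, `K ≠ 0`, `ε < 1` and a strain level
`m > 0`: a straight segment of direction `K` along which `K` is `ε`-aligned with the top frame and
`λ₁ ≥ m` has parameter length `b − a ≤ 2M / ((1 − ε) ‖K‖ m)`, i.e. EUCLIDEAN LENGTH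
`‖K‖ (b − a) ≤ 2M / ((1 − ε) m)` — aligned fibres live at the velocity scale `‖v‖_∞ / m`. [ours] -/
theorem aligned_segment_length_le (hv : Torus.IsSmooth v) {K : EuclideanSpace ℝ d} (hK : K ≠ 0)
    (x : UnitAddTorus d) {a b ε m M : ℝ} (hab : a ≤ b) (hε : ε < 1) (hm0 : 0 < m)
    (hM : ∀ y, ‖v y‖ ≤ M)
    (hal : ∀ t ∈ Icc a b, (1 - ε) * ‖K‖ ^ 2 * torusStrainTopEig v (x + Torus.proj (t • K)) ≤
      ∑ i, ∑ j, K i * torusStrainMatrix v (x + Torus.proj (t • K)) i j * K j)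
    (hm : ∀ t ∈ Icc a b, m ≤ torusStrainTopEig v (x + Torus.proj (t • K))) :
    ‖K‖ * (b - a) ≤ 2 * M / ((1 - ε) * m) := by
  have hKn : 0 < ‖K‖ := norm_pos_iff.mpr hK
  have h1 := aligned_segment_length_mul_le hv K x hab hε.le hal hm
  have h2 := abs_inner_sub_inner_le_norm_mul K (v (x + Torus.proj (b • K))) (v (x + Torus.proj (a • K)))
  have h3 : ⟪K, v (x + Torus.proj (b • K))⟫_ℝ - ⟪K, v (x + Torus.proj (a • K))⟫_ℝ ≤ ‖K‖ * (M + M) :=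
    (le_abs_self _).trans (h2.trans (mul_le_mul_of_nonneg_left (add_le_add (hM _) (hM _)) hKn.le))
  have hpos : 0 < (1 - ε) * m := mul_pos (sub_pos.mpr hε) hm0
  rw [le_div_iff₀ hpos]
  have h4 : ‖K‖ * (‖K‖ * (b - a) * ((1 - ε) * m)) ≤ ‖K‖ * (2 * M) := by nlinarith
  exact le_of_mul_le_mul_left h4 hKn

end General

/-! ## 4. Rayleigh bounds for a non-unit vector (`T³`, divergence free) -/

variable {v : UnitAddTorus (Fin 3) → EuclideanSpace ℝ (Fin 3)}

/-- `∑ᵢ Kᵢ Kᵢ = ‖K‖²`. [folklore] -/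
theorem sum_mul_self_eq_norm_sq (K : EuclideanSpace ℝ (Fin 3)) : ∑ i, K i * K i = ‖K‖ ^ 2 := by
  rw [EuclideanSpace.real_norm_sq_eq]
  exact Finset.sum_congr rfl fun i _ => by ring

/-- **`Kᵀ S(y) K ≤ ‖K‖² λ₁(y)`** (Rayleigh, tree `BiaxialEikonal.quadStrain_le_top` at `K/‖K‖`).
[folklore] -/
theorem quadStrain_le_norm_sq_mul_top (v : UnitAddTorus (Fin 3) → EuclideanSpace ℝ (Fin 3))
    (K : EuclideanSpace ℝ (Fin 3)) (y : UnitAddTorus (Fin 3)) :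
    ∑ i, ∑ j, K i * torusStrainMatrix v y i j * K j ≤ ‖K‖ ^ 2 * torusStrainTopEig v y := by
  by_cases hK : K = 0
  · subst hK
    simp
  have hn : 0 < ‖K‖ := norm_pos_iff.mpr hK
  set e : Fin 3 → ℝ := fun i => ‖K‖⁻¹ * K i with he_def
  have he : e ⬝ᵥ e = 1 := by
    have h1 : e ⬝ᵥ e = ‖K‖⁻¹ ^ 2 * ∑ i, K i * K i := by
      simp only [dotProduct, he_def, Finset.mul_sum]
      exact Finset.sum_congr rfl fun i _ => by ring
    rw [h1, sum_mul_self_eq_norm_sq]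
    field_simp
  have hexp : ∑ i, ∑ j, e i * torusStrainMatrix v y i j * e j =
      ‖K‖⁻¹ ^ 2 * ∑ i, ∑ j, K i * torusStrainMatrix v y i j * K j := by
    simp only [he_def, Finset.mul_sum]
    exact Finset.sum_congr rfl fun i _ => Finset.sum_congr rfl fun j _ => by ring
  have h := quadStrain_le_top v y he
  rw [hexp] at h
  have h2 : ‖K‖ ^ 2 * (‖K‖⁻¹ ^ 2 * ∑ i, ∑ j, K i * torusStrainMatrix v y i j * K j) ≤
      ‖K‖ ^ 2 * torusStrainTopEig v y := mul_le_mul_of_nonneg_left h (sq_nonneg _)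
  have h3 : ‖K‖ ^ 2 * (‖K‖⁻¹ ^ 2 * ∑ i, ∑ j, K i * torusStrainMatrix v y i j * K j) =
      ∑ i, ∑ j, K i * torusStrainMatrix v y i j * K j := by
    field_simp
  linarith

/-- **`−2 ‖K‖² λ₁(y) ≤ Kᵀ S(y) K`** on a divergence-free field (`Kᵀ S K ≥ ‖K‖² λ₃ ≥ −2 ‖K‖² λ₁`,
tree `BiaxialEikonal.neg_two_mul_top_le_quadStrain` at `K/‖K‖`). [folklore] -/
theorem neg_two_mul_norm_sq_mul_top_le_quadStrain (hv : Torus.IsSmooth v) (hdiv : Torus.IsDivFree v)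
    (K : EuclideanSpace ℝ (Fin 3)) (y : UnitAddTorus (Fin 3)) :
    -2 * ‖K‖ ^ 2 * torusStrainTopEig v y ≤ ∑ i, ∑ j, K i * torusStrainMatrix v y i j * K j := by
  by_cases hK : K = 0
  · subst hK
    simp
  have hn : 0 < ‖K‖ := norm_pos_iff.mpr hK
  set e : Fin 3 → ℝ := fun i => ‖K‖⁻¹ * K i with he_def
  have he : e ⬝ᵥ e = 1 := by
    have h1 : e ⬝ᵥ e = ‖K‖⁻¹ ^ 2 * ∑ i, K i * K i := by
      simp only [dotProduct, he_def, Finset.mul_sum]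
      exact Finset.sum_congr rfl fun i _ => by ring
    rw [h1, sum_mul_self_eq_norm_sq]
    field_simp
  have hexp : ∑ i, ∑ j, e i * torusStrainMatrix v y i j * e j =
      ‖K‖⁻¹ ^ 2 * ∑ i, ∑ j, K i * torusStrainMatrix v y i j * K j := by
    simp only [he_def, Finset.mul_sum]
    exact Finset.sum_congr rfl fun i _ => Finset.sum_congr rfl fun j _ => by ring
  have h := neg_two_mul_top_le_quadStrain (d := Fin 3) (by simp) hv hdiv y he
  rw [hexp] at h
  have h2 : ‖K‖ ^ 2 * (-2 * torusStrainTopEig v y) ≤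
      ‖K‖ ^ 2 * (‖K‖⁻¹ ^ 2 * ∑ i, ∑ j, K i * torusStrainMatrix v y i j * K j) :=
    mul_le_mul_of_nonneg_left h (sq_nonneg _)
  have h3 : ‖K‖ ^ 2 * (‖K‖⁻¹ ^ 2 * ∑ i, ∑ j, K i * torusStrainMatrix v y i j * K j) =
      ∑ i, ∑ j, K i * torusStrainMatrix v y i j * K j := by
    field_simp
  linarith

/-- Continuity of `λ₁` along a line. [folklore] -/
theorem continuous_topEig_along (hv : Torus.IsSmooth v) (K : EuclideanSpace ℝ (Fin 3))
    (x : UnitAddTorus (Fin 3)) :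
    Continuous fun t : ℝ => torusStrainTopEig v (x + Torus.proj (t • K)) :=
  (continuous_torusStrainTopEig hv).comp
    (continuous_const.add (Torus.continuous_proj.comp (continuous_id.smul continuous_const)))

/-- **LINE MISALIGNMENT = LINE MASS** on closed lattice lines: for `K = latticeVec k`,
`∫₀¹ (‖K‖² λ₁ − Kᵀ S K)(x + proj (t • K)) dt = ‖K‖² ∫₀¹ λ₁(x + proj (t • K)) dt`, with the pointwise
sandwich `0 ≤ ‖K‖² λ₁ − Kᵀ S K ≤ 3 ‖K‖² λ₁` (divergence free). [ours] -/
theorem setIntegral_norm_sq_mul_top_sub_quadStrain_eq (hv : Torus.IsSmooth v) (k : Fin 3 → ℤ)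
    (x : UnitAddTorus (Fin 3)) :
    ∫ t in Ioc (0 : ℝ) 1, (‖Torus.latticeVec k‖ ^ 2 *
        torusStrainTopEig v (x + Torus.proj (t • Torus.latticeVec k)) -
        ∑ i, ∑ j, Torus.latticeVec k i *
          torusStrainMatrix v (x + Torus.proj (t • Torus.latticeVec k)) i j * Torus.latticeVec k j) =
      ‖Torus.latticeVec k‖ ^ 2 *
        ∫ t in Ioc (0 : ℝ) 1, torusStrainTopEig v (x + Torus.proj (t • Torus.latticeVec k)) := by
  have hLi : IntegrableOn (fun t : ℝ => torusStrainTopEig v (x + Torus.proj (t • Torus.latticeVec k)))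
      (Ioc (0 : ℝ) 1) :=
    (continuous_topEig_along hv _ x).integrableOn_Icc.mono_set Ioc_subset_Icc_self
  have hQi : IntegrableOn (fun t : ℝ => ∑ i, ∑ j, Torus.latticeVec k i *
      torusStrainMatrix v (x + Torus.proj (t • Torus.latticeVec k)) i j * Torus.latticeVec k j)
      (Ioc (0 : ℝ) 1) :=
    (continuous_quadStrain_along hv _ x).integrableOn_Icc.mono_set Ioc_subset_Icc_self
  rw [integral_sub (hLi.const_mul _) hQi, setIntegral_quadStrain_latticeLine_eq_zero hv k x, sub_zero,
    integral_const_mul]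

end LatticeLineFibre

end TopEig

end Summit.NavierStokesRegularity.FunctionalMining
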